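import Mathlib

/-!
# Bordered eigenpair certificate II: the fixed-point step, perturbation-injectivity and reality by isolation (instab g8, cell `ns-blowup`, 2026-08-25)

HONEST FRAMING (human ruling D-0035): nothing here is a claim about Navier–Stokes blow-up.
WHAT THIS IS NOT: not NS evidence. These are the abstract facts behind steps (b), (c), (d) and remark
(r6) of THEOREM 3-B of `instab/CERT-ROPE-X0.md` (the BORDERED skew-cut certificate for a simple,
isolated eigenPAIR of the MODEL operator «NS linearised about the forced ABC flow», crux X0 of lane
N1*), complementing `BorderedEigenpairCertificate.lean` (K-B1–K-B3). Together they make 3-B kernel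
MODULO exactly two analytic inputs that stay paper-grade: (a) the bound `‖𝔅⁻¹‖ ≤ M` for the bordered
operator (Lax–Milgram on the Fourier tail) and the compact-resolvent facts used for algebraic
multiplicity. Everything below is stated for abstract normed spaces / modules; the note instantiates
`E` = smooth divergence-free fields, `φ = ⟪·, ṽ⟫`, `X` = the augmented Hilbert space `H × ℂ`.

* `bordered_eq_iff_eigenpair` (K-B5) — with residual `r := λ̃•ṽ − Lṽ` and `φ ṽ = 1`, the bordered
  equation `𝔅(ṽ − v, λ̃ − λ) = (r + (λ − λ̃)•(v − ṽ), 0)` holds IFF `L v = λ•v ∧ φ v = 1`: fixed points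
  of the Newton-like map `Φ(x) = x₀ − 𝔅⁻¹(r + Q x, 0)` are exactly the normalised eigenpairs.
* `norm_quad_le` / `norm_quad_sub_quad_le` (K-B4′) — the quadratic term `Q(v, λ) = (λ − λ̃)•(v − ṽ)`
  obeys `‖Q‖ ≤ ρ²/2` on the ball `‖v − ṽ‖² + ‖λ − λ̃‖² ≤ ρ²` and is `√2·ρ`-Lipschitz there (for the
  `ℓ²` pairing of the two components).
* `existsUnique_fixedPoint_of_kappa_lt_one` (K-B4) — the Newton–Kantorovich ball step: for a bounded
  linear `S` (`= 𝔅⁻¹∘ι`) with `‖S‖ ≤ M`, a residual `R` with `‖R‖ ≤ r`, and any `Q` with the two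
  bounds above on the closed ball of radius `ρ = 2Mr` about `x₀`, the hypothesis
  `κ := 2√2·M²·r < 1` gives EXACTLY ONE `x` in that ball with `x = x₀ − S (R + Q x)` (Banach).
* `injective_of_bound_below` (K-B6) — if `m‖x‖ ≤ ‖B x‖` and `‖P x‖ ≤ δ‖x‖` with `δ < m`, then
  `B + P` is injective (the Neumann step giving injectivity of `𝔅*` and `𝔅*_z`, hence K-B1–K-B3);
  `bound_below_of_leftInverse` — `‖S y‖ ≤ M‖y‖`, `S (B x) = x`, `0 < M` ⇒ `M⁻¹‖x‖ ≤ ‖B x‖`.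
* `im_eq_zero_of_isolated` (K-B7, remark r6) — if the spectrum-like set `σ` is invariant under complex
  conjugation, `λ̃` is real, `λ⋆ ∈ σ` with `‖λ⋆ − λ̃‖ ≤ ρ`, and `λ⋆` is the only point of `σ` within
  distance `riso > 2ρ` of itself, then `λ⋆` is REAL — reality by isolation, without a `J`-real `ṽ`.

Mathlib only; no new definitions.
-/

namespace Summit.NavierStokesRegularity.FluidComputer.BorderedEigenpairFixedPoint

section Algebra

variable {𝕜 : Type*} [Field 𝕜] {E : Type*} [AddCommGroup E] [Module 𝕜 E]
variable (L : E →ₗ[𝕜] E) (φ : E →ₗ[𝕜] 𝕜) (vt : E) (lt : 𝕜)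

/-- **K-B5 (fixed points of the bordered Newton map are exactly the normalised eigenpairs).**
Let `r := λ̃•ṽ − L ṽ` be the residual of the approximate pair `(λ̃, ṽ) = (lt, vt)` and let the
normalising functional satisfy `φ ṽ = 1`. For any candidate pair `(v, λ) = (v, l)`, the bordered
equation `(λ̃ − L)(ṽ − v) + (λ̃ − λ)•ṽ = r + (λ − λ̃)•(v − ṽ)` together with `φ(ṽ − v) = 0` holds
if and only if `L v = λ•v` and `φ v = 1`. (Expanding, the two sides differ exactly by `L v − λ•v`.) -/
theorem bordered_eq_iff_eigenpair (hφ : φ vt = 1) (v : E) (l : 𝕜) :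
    ((lt • (vt - v) - L (vt - v)) + (lt - l) • vt = (lt • vt - L vt) + (l - lt) • (v - vt)
        ∧ φ (vt - v) = 0) ↔ (L v = l • v ∧ φ v = 1) := by
  have key : ∀ (a b : E),
      ((lt • (vt - v) - (a - b)) + (lt - l) • vt) - ((lt • vt - a) + (l - lt) • (v - vt))
        = b - l • v := by
    intro a b
    module
  have hφ' : φ (vt - v) = 0 ↔ φ v = 1 := by
    rw [map_sub, hφ, sub_eq_zero, eq_comm]
  constructor
  · rintro ⟨h1, h2⟩
    refine ⟨?_, hφ'.mp h2⟩
    have h := key (L vt) (L v)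
    rw [← map_sub, h1, sub_self] at h
    exact (sub_eq_zero.mp h.symm)
  · rintro ⟨hv, h2⟩
    refine ⟨?_, hφ'.mpr h2⟩
    have h := key (L vt) (L v)
    rw [← map_sub, hv, sub_self] at h
    exact (sub_eq_zero.mp h)

end Algebra

section Perturbation

variable {𝕜 : Type*} [NontriviallyNormedField 𝕜] {E' F : Type*}
  [NormedAddCommGroup E'] [NormedSpace 𝕜 E'] [NormedAddCommGroup F] [NormedSpace 𝕜 F]

/-- **K-B6 (injectivity survives a perturbation smaller than the lower bound).** If a linear map
`B` is bounded below, `m‖x‖ ≤ ‖B x‖`, and `P` is small, `‖P x‖ ≤ δ‖x‖` with `δ < m`, then `B + P` is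
injective — indeed `(m − δ)‖x‖ ≤ ‖(B + P) x‖`. In THEOREM 3-B this is the Neumann step: `𝔅* − 𝔅` has
norm `≤ √2ρ` and `M·√2ρ = κ < 1`, so `𝔅*` (and `𝔅*_z` for `|z − λ*| < 1/M*`) is injective, which is all
that K-B1–K-B3 consume. (`E'` is the operator's domain equipped with the ambient norm.) -/
theorem norm_le_of_bound_below_of_perturbation
    (B P : E' →ₗ[𝕜] F) {m δ : ℝ}
    (hB : ∀ x, m * ‖x‖ ≤ ‖B x‖) (hP : ∀ x, ‖P x‖ ≤ δ * ‖x‖) (x : E') :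
    (m - δ) * ‖x‖ ≤ ‖(B + P) x‖ := by
  have h1 := hB x
  have h2 := hP x
  have h3 : ‖B x‖ ≤ ‖(B + P) x‖ + ‖P x‖ := by
    have : B x = (B + P) x - P x := by simp
    rw [this] at *
    exact norm_sub_le _ _ |>.trans (by simp)
  nlinarith

/-- **K-B6.** Bounded below by `m`, perturbed by at most `δ < m` ⇒ injective. -/
theorem injective_of_bound_below
    (B P : E' →ₗ[𝕜] F) {m δ : ℝ}
    (hB : ∀ x, m * ‖x‖ ≤ ‖B x‖) (hP : ∀ x, ‖P x‖ ≤ δ * ‖x‖) (hδ : δ < m) :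
    Function.Injective (B + P) := by
  intro x y hxy
  have h := norm_le_of_bound_below_of_perturbation B P hB hP (x - y)
  rw [map_sub, hxy, sub_self, norm_zero] at h
  have hpos : 0 < m - δ := sub_pos.mpr hδ
  have : ‖x - y‖ ≤ 0 := by nlinarith [norm_nonneg (x - y)]
  exact sub_eq_zero.mp (norm_le_zero_iff.mp this)

/-- **Lower bound from a bounded left inverse.** If `S (B x) = x` for all `x` in the domain and
`‖S y‖ ≤ M‖y‖` with `0 < M`, then `M⁻¹‖x‖ ≤ ‖B x‖` — the form in which THEOREM 3-B(a)'s conclusion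
`‖𝔅⁻¹‖ ≤ M` feeds K-B6. -/
theorem bound_below_of_leftInverse
    (B : E' →ₗ[𝕜] F) (S : F → E') {M : ℝ} (hM : 0 < M)
    (hS : ∀ y, ‖S y‖ ≤ M * ‖y‖) (hSB : ∀ x, S (B x) = x) (x : E') :
    M⁻¹ * ‖x‖ ≤ ‖B x‖ := by
  have h := hS (B x)
  rw [hSB] at h
  rw [inv_mul_le_iff₀ hM]
  exact h

end Perturbation

section Reality

/-- **K-B7 (reality by isolation, remark r6 of THEOREM 3-B).** Let `σ ⊆ ℂ` be invariant under
complex conjugation (the spectrum of a REAL operator on a `J`-invariant class), `λ̃ ∈ ℝ` the float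
eigenvalue, `λ⋆ ∈ σ` the certified one with `‖λ⋆ − λ̃‖ ≤ ρ`, and suppose `λ⋆` is isolated in `σ` with
radius `riso > 2ρ`. Then `conj λ⋆ ∈ σ` lies within `2ρ < riso` of `λ⋆`, hence equals it: `λ⋆` is real.
No `J`-reality of the float eigenvector `ṽ` is needed. -/
theorem im_eq_zero_of_isolated (σ : Set ℂ) (hσ : ∀ z ∈ σ, (starRingEnd ℂ) z ∈ σ)
    (lt : ℝ) (lam : ℂ) (hlam : lam ∈ σ) {ρ riso : ℝ}
    (hclose : ‖lam - (lt : ℂ)‖ ≤ ρ) (hiso : ∀ z ∈ σ, ‖z - lam‖ < riso → z = lam) (h2ρ : 2 * ρ < riso) :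
    lam.im = 0 := by
  have hc : (starRingEnd ℂ) lam ∈ σ := hσ lam hlam
  have hdist : ‖(starRingEnd ℂ) lam - lam‖ < riso := by
    have h1 : ‖(starRingEnd ℂ) lam - (lt : ℂ)‖ = ‖lam - (lt : ℂ)‖ := by
      rw [← Complex.norm_conj (lam - (lt : ℂ)), map_sub, Complex.conj_ofReal]
    calc ‖(starRingEnd ℂ) lam - lam‖
        = ‖((starRingEnd ℂ) lam - (lt : ℂ)) - (lam - (lt : ℂ))‖ := by ring_nf
      _ ≤ ‖(starRingEnd ℂ) lam - (lt : ℂ)‖ + ‖lam - (lt : ℂ)‖ := norm_sub_le _ _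
      _ = 2 * ‖lam - (lt : ℂ)‖ := by rw [h1]; ring
      _ ≤ 2 * ρ := by linarith
      _ < riso := h2ρ
  have heq : (starRingEnd ℂ) lam = lam := hiso _ hc hdist
  exact Complex.conj_eq_iff_im.mp heq

end Reality

section Quadratic

variable {𝕜 : Type*} [RCLike 𝕜] {H : Type*} [NormedAddCommGroup H] [NormedSpace 𝕜 H]

/-- `a·b ≤ (a² + b²)/2 ≤ ρ²/2`: the quadratic term `Q(v, λ) = (λ − λ̃)•(v − ṽ)` of the eigenproblem
has norm at most `ρ²/2` on the ball `‖v − ṽ‖² + ‖λ − λ̃‖² ≤ ρ²` (K-B4′, self-map estimate). -/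
theorem norm_quad_le (vt v : H) (lt l : 𝕜) {ρ : ℝ}
    (h : ‖v - vt‖ ^ 2 + ‖l - lt‖ ^ 2 ≤ ρ ^ 2) :
    ‖(l - lt) • (v - vt)‖ ≤ ρ ^ 2 / 2 := by
  rw [norm_smul]
  nlinarith [sq_nonneg (‖l - lt‖ - ‖v - vt‖), norm_nonneg (l - lt), norm_nonneg (v - vt)]

/-- **K-B4′ (Lipschitz estimate of the quadratic term on the ball).** For `(v, λ)`, `(v′, λ′)` in the
ball `‖· − ṽ‖² + ‖· − λ̃‖² ≤ ρ²` (`ρ ≥ 0`),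
`‖(λ − λ̃)•(v − ṽ) − (λ′ − λ̃)•(v′ − ṽ)‖ ≤ √2·ρ·√(‖v − v′‖² + ‖λ − λ′‖²)`
(write the difference as `(λ − λ′)•(v − ṽ) + (λ′ − λ̃)•(v − v′)`). With `‖𝔅⁻¹‖ ≤ M` this makes the
Newton map `κ = √2·ρ·M = 2√2·M²·‖r‖`-Lipschitz. -/
theorem norm_quad_sub_quad_le (vt v v' : H) (lt l l' : 𝕜) {ρ : ℝ} (hρ : 0 ≤ ρ)
    (h : ‖v - vt‖ ^ 2 + ‖l - lt‖ ^ 2 ≤ ρ ^ 2) (h' : ‖v' - vt‖ ^ 2 + ‖l' - lt‖ ^ 2 ≤ ρ ^ 2) :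
    ‖(l - lt) • (v - vt) - (l' - lt) • (v' - vt)‖
      ≤ Real.sqrt 2 * ρ * Real.sqrt (‖v - v'‖ ^ 2 + ‖l - l'‖ ^ 2) := by
  have hv : ‖v - vt‖ ≤ ρ := by
    calc ‖v - vt‖ = Real.sqrt (‖v - vt‖ ^ 2) := (Real.sqrt_sq (norm_nonneg _)).symm
      _ ≤ Real.sqrt (ρ ^ 2) := Real.sqrt_le_sqrt (by nlinarith [sq_nonneg ‖l - lt‖])
      _ = ρ := Real.sqrt_sq hρ
  have hl' : ‖l' - lt‖ ≤ ρ := by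
    calc ‖l' - lt‖ = Real.sqrt (‖l' - lt‖ ^ 2) := (Real.sqrt_sq (norm_nonneg _)).symm
      _ ≤ Real.sqrt (ρ ^ 2) := Real.sqrt_le_sqrt (by nlinarith [sq_nonneg ‖v' - vt‖])
      _ = ρ := Real.sqrt_sq hρ
  have hsplit : (l - lt) • (v - vt) - (l' - lt) • (v' - vt)
      = (l - l') • (v - vt) + (l' - lt) • (v - v') := by
    simp only [sub_smul, smul_sub]
    abel
  rw [hsplit]
  calc ‖(l - l') • (v - vt) + (l' - lt) • (v - v')‖
      ≤ ‖(l - l') • (v - vt)‖ + ‖(l' - lt) • (v - v')‖ := norm_add_le _ _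
    _ = ‖l - l'‖ * ‖v - vt‖ + ‖l' - lt‖ * ‖v - v'‖ := by rw [norm_smul, norm_smul]
    _ ≤ ‖l - l'‖ * ρ + ρ * ‖v - v'‖ := by
        gcongr
    _ = ρ * (‖v - v'‖ + ‖l - l'‖) := by ring
    _ ≤ ρ * (Real.sqrt 2 * Real.sqrt (‖v - v'‖ ^ 2 + ‖l - l'‖ ^ 2)) := by
        gcongr
        -- `a + b ≤ √2·√(a² + b²)` (Cauchy–Schwarz in `ℝ²`)
        set a := ‖v - v'‖
        set b := ‖l - l'‖
        rw [← Real.sqrt_mul (by norm_num : (0:ℝ) ≤ 2)]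
        have hab : 0 ≤ a + b := by positivity
        rw [← Real.sqrt_sq hab]
        exact Real.sqrt_le_sqrt (by nlinarith [sq_nonneg (a - b)])
    _ = Real.sqrt 2 * ρ * Real.sqrt (‖v - v'‖ ^ 2 + ‖l - l'‖ ^ 2) := by ring

end Quadratic

section Banach

variable {𝕜 : Type*} [NontriviallyNormedField 𝕜] {X : Type*} [NormedAddCommGroup X] [NormedSpace 𝕜 X]
  [CompleteSpace X]

/-- **K-B4 (the Newton–Kantorovich ball step of THEOREM 3-B(b)).** Let `S : X → X` be a bounded linear
map with `‖S‖ ≤ M` (the bordered inverse composed with the embedding `w ↦ (w, 0)`), `R ∈ X` a residual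
with `‖R‖ ≤ r`, and `Q : X → X` any map with `‖Q x‖ ≤ ρ²/2` and `‖Q x − Q x′‖ ≤ √2ρ‖x − x′‖` on the
closed ball of radius `ρ := 2Mr` about `x₀` (K-B4′ supplies both for the eigenproblem's quadratic term).
If `κ := 2√2·M²·r < 1` then there is EXACTLY ONE `x` in that ball with `x = x₀ − S (R + Q x)`.
Proof: `Φ x := x₀ − S(R + Q x)` maps the ball into itself (`M(r + ρ²/2) ≤ ρ` because `2M²r ≤ 1`) and
is `κ`-Lipschitz there; Banach's fixed-point theorem on the complete ball. -/
theorem existsUnique_fixedPoint_of_kappa_lt_one (S : X →L[𝕜] X) (x₀ R : X) (Q : X → X) {M r : ℝ}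
    (hM : 0 ≤ M) (hr : 0 ≤ r) (hS : ‖S‖ ≤ M) (hR : ‖R‖ ≤ r)
    (hκ : 2 * Real.sqrt 2 * M ^ 2 * r < 1)
    (hQ0 : ∀ x ∈ Metric.closedBall x₀ (2 * M * r), ‖Q x‖ ≤ (2 * M * r) ^ 2 / 2)
    (hQ1 : ∀ x ∈ Metric.closedBall x₀ (2 * M * r), ∀ x' ∈ Metric.closedBall x₀ (2 * M * r),
      ‖Q x - Q x'‖ ≤ Real.sqrt 2 * (2 * M * r) * ‖x - x'‖) :
    ∃! x, x ∈ Metric.closedBall x₀ (2 * M * r) ∧ x = x₀ - S (R + Q x) := by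
  set ρ : ℝ := 2 * M * r with hρdef
  set κ : ℝ := 2 * Real.sqrt 2 * M ^ 2 * r with hκdef
  have hρ : 0 ≤ ρ := by positivity
  have hκ0 : 0 ≤ κ := by positivity
  have hsqrt2 : (1:ℝ) ≤ Real.sqrt 2 := by
    rw [show (1:ℝ) = Real.sqrt 1 by simp]
    exact Real.sqrt_le_sqrt (by norm_num)
  -- the Newton-like map
  set Φ : X → X := fun x => x₀ - S (R + Q x) with hΦ
  -- self-map of the closed ball
  have hmaps : Set.MapsTo Φ (Metric.closedBall x₀ ρ) (Metric.closedBall x₀ ρ) := by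
    intro x hx
    rw [Metric.mem_closedBall, dist_eq_norm]
    have hQx := hQ0 x hx
    have h1 : ‖Φ x - x₀‖ = ‖S (R + Q x)‖ := by
      simp only [hΦ, sub_sub_cancel_left, norm_neg]
    rw [h1]
    have h2 : ‖S (R + Q x)‖ ≤ M * (r + ρ ^ 2 / 2) := by
      calc ‖S (R + Q x)‖ ≤ ‖S‖ * ‖R + Q x‖ := S.le_opNorm _
        _ ≤ M * (‖R‖ + ‖Q x‖) := by
            gcongr
            exact norm_add_le _ _
        _ ≤ M * (r + ρ ^ 2 / 2) := by gcongr
    have h3 : M * (r + ρ ^ 2 / 2) ≤ ρ := by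
      -- ρ² /2 = 2 M² r², and 2 M² r ≤ 2√2 M² r < 1
      have h2M : 2 * M ^ 2 * r ≤ 1 := by nlinarith [sq_nonneg M]
      have : M * (ρ ^ 2 / 2) = (2 * M ^ 2 * r) * (M * r) := by rw [hρdef]; ring
      nlinarith [mul_nonneg hM hr]
    exact h2.trans h3
  -- contraction on the ball
  have hlip : LipschitzOnWith ⟨κ, hκ0⟩ Φ (Metric.closedBall x₀ ρ) := by
    apply LipschitzOnWith.of_dist_le_mul
    intro x hx y hy
    rw [dist_eq_norm, dist_eq_norm]
    have h1 : Φ x - Φ y = S (Q y - Q x) := by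
      simp only [hΦ, map_add, map_sub]
      abel
    rw [h1]
    calc ‖S (Q y - Q x)‖ ≤ ‖S‖ * ‖Q y - Q x‖ := S.le_opNorm _
      _ ≤ M * (Real.sqrt 2 * ρ * ‖y - x‖) := by
          gcongr
          exact hQ1 y hy x hx
      _ = κ * ‖x - y‖ := by rw [norm_sub_rev, hρdef, hκdef]; ring
  have hcomplete : IsComplete (Metric.closedBall x₀ ρ) := Metric.isClosed_closedBall.isComplete
  have hcontr : ContractingWith ⟨κ, hκ0⟩ (hmaps.restrict Φ _ _) := by
    refine ⟨?_, ?_⟩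
    · exact_mod_cast hκ
    · exact (lipschitzOnWith_iff_restrict.mp hlip)
  have hx₀ : x₀ ∈ Metric.closedBall x₀ ρ := Metric.mem_closedBall_self hρ
  obtain ⟨y, hy, hfix, -⟩ :=
    hcontr.exists_fixedPoint' hcomplete hmaps hx₀ (edist_ne_top _ _)
  refine ⟨y, ⟨hy, ?_⟩, ?_⟩
  · exact hfix.symm
  · rintro x ⟨hx, hxfix⟩
    -- uniqueness from the contraction estimate
    have h := hlip.dist_le_mul x hx y hy
    have hΦx : Φ x = x := by simp only [hΦ]; exact hxfix.symm
    rw [hΦx, show Φ y = y from hfix] at h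
    change dist x y ≤ κ * dist x y at h
    have hd : dist x y ≤ 0 := by nlinarith [dist_nonneg (x := x) (y := y)]
    exact dist_le_zero.mp hd

end Banach

end Summit.NavierStokesRegularity.FluidComputer.BorderedEigenpairFixedPoint
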